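import Mathlib
import HarnessLib
import Summits.NavierStokesRegularity.NavierStokesRegularity.Theorems.UnthreadedRigidityDoorUnthreadedRigidityMixedPairWindowRigidityHolds
import Summits.NavierStokesRegularity.NavierStokesRegularity.Theorems.UnthreadedRigidityDoorUnthreadedRigidityMixedPairCorelessDefs

/-!
# Route `UnthreadedRigidityDoor`, item `UnthreadedRigidity` (W2, stmt-NavierStokesRegularity-27585) — LINE g11-2 «MIXED PAIR», MAGIC SECTOR:
# ★★ the magic-angle WINDOW items G-W / G-W(AE) and the magic WINDOW rungs hold UNCONDITIONALLY (pair windows are empty)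

Prover file (engine-1 g73; `--supports stmt-NavierStokesRegularity-27585 --as helper`; route-independent imports).

`MixedPair.pairWindow_vanishes` (file `…MixedPairWindowRigidityHolds`, p727688) says a bounded mild window whose slices are admissible pairs over a
FIXED axis and a FIXED traceless symmetric `Q` — ANY shape, in particular the MAGIC-ANGLE uniaxial shape of part 2 of the line — is identically
zero, with null profiles.  Hence the four magic WINDOW statements of `…MixedPairMagicDefs` / `…MixedPairCorelessDefs` hold by bookkeeping, with
their extra hypotheses (core at every slice, `PellBranchPositivity`) unused:
* ★ `magicWindowReduction_holds : MixedPair.MagicWindowReduction` (G-W: the quadrupole profile of every slice is null — `IsMagic` gives `Qa ≠ 0`,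
  so `Q ≠ 0` and `pairWindow_quadProfile_null` applies);
* ★ `magicWindowReductionAE_holds : MixedPair.MagicWindowReductionAE` (G-W(AE): the dipole profile of every slice is null, `Or.inl`);
* ★★ `magicPairWindowRigidity_holds : MixedPair.MagicPairWindowRigidity` and ★★ `magicPairWindowRigidityAE_holds : MixedPair.MagicPairWindowRigidityAE`
  (the magic WINDOW RUNGS, cored and all-slices forms): the zero window is infinitesimally axisymmetric (`VirialHorn.exists_skew_ne_zero`).
The magic SLICE statements (BRIDGE G `MagicGermRigidity`, `MagicPairOrderTwoRigidity(AE)`, `MagicCorelessRigidity`, `PellBranchPositivity`) are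
one-instant statements and are NOT touched.

HONEST LABEL: window items about SPECIAL hypothetical pair windows, closed by EMPTINESS of the class; support for `UnthreadedRigidity` (27585), which
stays OPEN with the door Target, W2 and Navier–Stokes regularity; no summit statement is proved.  MODEL/rung work; 0 kit.
-/

noncomputable section

-- the summit and its single sub-problem share the name (CONVENTIONS §1), as in every Theorems file
set_option linter.dupNamespace false

namespace Summit.NavierStokesRegularity.NavierStokesRegularity.Theorems.UnthreadedRigidity.MixedPair

open Set Function Filter Topology
open scoped RealInnerProductSpace
open Literature.Analysis Literature.Analysis.FluidPDE
open Literature.Analysis.UnboundedOperators (heatExtension)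
open Summit.NavierStokesRegularity.NavierStokesRegularity.Theorems.UnthreadedRigidity.ProfileHorn (E3)
open Summit.NavierStokesRegularity.NavierStokesRegularity.Theorems.UnthreadedRigidity.VirialHorn (exists_skew_ne_zero)

/-- a magic configuration has `Q ≠ 0` (`Qa ≠ 0`). -/
theorem IsMagic.ne_zero {a : E3} {Q : E3 →L[ℝ] E3} (h : IsMagic a Q) : Q ≠ 0 := by
  rintro rfl
  exact h.2.1 (by simp)

/-- ★ BRIDGE G-W «MAGIC WINDOW REDUCTION» HOLDS UNCONDITIONALLY. -/
theorem magicWindowReduction_holds : MixedPair.MagicWindowReduction := by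
  intro S hS u x₀ hcont hdiv hmild hbdd _ a Q H₁f H₂f hmag hslice t ht
  have hslice' : ∀ t ∈ S, PairAdmissible (H₁f t) (H₂f t) a Q ∧ u t = pairShell (H₁f t) (H₂f t) a Q x₀ :=
    fun s hs => ⟨(hslice s hs).1, (hslice s hs).2.2⟩
  exact pairWindow_quadProfile_null hS hcont hdiv hmild hbdd (IsMagic.ne_zero hmag) hslice' ht

/-- ★ BRIDGE G-W (AE) «MAGIC WINDOW REDUCTION, all slices» HOLDS UNCONDITIONALLY (the dipole profile is null; `PellBranchPositivity` unused). -/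
theorem magicWindowReductionAE_holds : MixedPair.MagicWindowReductionAE := by
  intro _ S hS u x₀ hcont hdiv hmild hbdd _ a Q H₁f H₂f _ hslice t ht
  exact Or.inl (pairWindow_dipoleProfile_null hS hcont hdiv hmild hbdd hslice ht)

/-- ★★ THE MAGIC WINDOW RUNG (cored form) HOLDS UNCONDITIONALLY. -/
theorem magicPairWindowRigidity_holds : MixedPair.MagicPairWindowRigidity := by
  intro S hS _ u x₀ hcont hdiv hmild hbdd _ hpair
  obtain ⟨a, Q, H₁f, H₂f, _, hslice⟩ := hpair
  have hslice' : ∀ t ∈ S, PairAdmissible (H₁f t) (H₂f t) a Q ∧ u t = pairShell (H₁f t) (H₂f t) a Q x₀ :=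
    fun s hs => ⟨(hslice s hs).1, (hslice s hs).2.2⟩
  have hzero := pairWindow_vanishes hS hcont hdiv hmild hbdd hslice'
  obtain ⟨A, hskew, hA0⟩ := exists_skew_ne_zero
  refine ⟨A, hskew, hA0, fun t ht x => ?_⟩
  have hut : u t = fun _ => (0 : E3) := funext (hzero t ht)
  rw [hut]
  simp

/-- ★★ THE MAGIC WINDOW RUNG (all slices, AE form) HOLDS UNCONDITIONALLY. -/
theorem magicPairWindowRigidityAE_holds : MixedPair.MagicPairWindowRigidityAE := by
  intro S hS _ u x₀ hcont hdiv hmild hbdd _ hpair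
  obtain ⟨a, Q, H₁f, H₂f, _, hslice⟩ := hpair
  have hzero := pairWindow_vanishes hS hcont hdiv hmild hbdd hslice
  obtain ⟨A, hskew, hA0⟩ := exists_skew_ne_zero
  refine ⟨A, hskew, hA0, fun t ht x => ?_⟩
  have hut : u t = fun _ => (0 : E3) := funext (hzero t ht)
  rw [hut]
  simp

end Summit.NavierStokesRegularity.NavierStokesRegularity.Theorems.UnthreadedRigidity.MixedPair

end
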